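import Summits.RiemannHypothesis.RiemannHypothesis.Theses.GroundBarta
import Summits.RiemannHypothesis.RiemannHypothesis.Theorems.OddSectorOddNegativityOffLine
import HarnessLib

/-!
# Route GroundBarta — `OddNegativityOffLine` (item stmt-RiemannHypothesis-18391)

SHARED SUPPORT, re-asked verbatim from route `OddSector` (item stmt-RiemannHypothesis-17780, proved by
`Summit.RiemannHypothesis.RiemannHypothesis.Theorems.oddNegativityOffLine_proof` in
`Theorems/OddSectorOddNegativityOffLine.lean`): Yoshida's odd criterion in contrapositive,
window-uniform — if RH fails there are `η > 0` and `A` such that every window `a ≥ A` carries an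
`L²`-normalised smooth ODD test `h` supported in `[-a, a]` with `Re Q(h) ≤ -η`, `Q` being Weil's
quadratic functional written out over Mathlib primitives.

The two route declarations `GroundBarta.OddNegativityOffLine` and `OddSector.OddNegativityOffLine` are
syntactically identical `Prop`s, so the landed OddSector theorem closes this item by definitional
transport (a term-mode one-liner; the kernel unfolds both `def`s).

References: H. Yoshida, *On Hermitian forms attached to zeta functions* (1992) [Yoshida1992HermitianForms,
Prop. 1(1)]; E. Bombieri, *Remarks on Weil's quadratic functional in the theory of prime numbers I* (2000)
[Bombieri2000Weil, §5].  Axioms: propext, Classical.choice, Quot.sound.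
-/

-- D-0017: single-problem summit ⇒ namespace `Summit.RiemannHypothesis.RiemannHypothesis.…` by design.
set_option linter.dupNamespace false

namespace Summit.RiemannHypothesis.RiemannHypothesis.Theorems.GroundBarta

/-- **Item stmt-RiemannHypothesis-18391** (`GroundBarta.OddNegativityOffLine`): if the Riemann hypothesis
fails, there are `η > 0` and a height `A` such that every window `a ≥ A` carries an `L²`-normalised smooth
odd test `h` supported in `[-a, a]` with `Re Q(h) ≤ -η`.  Definitional transport of the OddSector twin
`Theorems.oddNegativityOffLine_proof` (stmt-RiemannHypothesis-17780).
[cite: Yoshida1992HermitianForms, Prop. 1(1)] -/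
theorem oddNegativityOffLine_proof :
    Summit.RiemannHypothesis.RiemannHypothesis.Theses.GroundBarta.OddNegativityOffLine :=
  Summit.RiemannHypothesis.RiemannHypothesis.Theorems.oddNegativityOffLine_proof

end Summit.RiemannHypothesis.RiemannHypothesis.Theorems.GroundBarta
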